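import Summits.Ventures.Crystal3D.Theorems.StickyWulffConstantTextureLiminfTexShadowTwinPlanePropagation
import HarnessLib

/-!
# A located chain end that reads is a TWIN reading on a plane NOT containing the chain direction (input (I4) of the level ledger; cf-p1 RULING (ccxli))

HONEST FRAMING. Venture `Summits/Ventures/Crystal3D` (cell `crystal3d-full`), helper `--supports` the law-v5 crux `TextureLiminfV5` (stmt-Ventures-23912),
lane T, line `TexShadow`, registered stub `stub_terraceCensus`, LEDGER architecture (…TexShadowLevelLedgerDefs p732417: chains, located top ends, reads).
Finite geometry of the two kissing patterns; nothing about energies; F-C1 not moved.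

THE POINT.  In the level ledger a located top end `e` of a `c`-chain (`e − c ∈ X`, `e + c ∉ X`) either PAYS (≤ 11 contacts) or READS: its contact shell
is a close-packed dozen `D` around `e` with `e − c ∈ D` and `e + c ∉ D`.  This file pins down what a read can be:
* (`neg_mem_fccKissingPattern'`, private; the tree's `neg_mem_fccKissingPattern` lives in …SaturatedPocket) the cuboctahedron is centrally symmetric; hence **`not_fcc_read`**: an fcc-type dozen containing `e − c` contains `e + c`
  — an fcc-type ball is NEVER a located chain end (no read inside a grain);
* `neg_mem_hcpKissingPattern_of_hex` — the hexagon of the anticuboctahedron is centrally symmetric; hence **`read_is_polar`**: if an hcp-type dozen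
  `A·hcp + e` contains `e − c` but not `e + c`, then `−c = A p` for a CAP vector `p` (`⟪p, (1,1,1)⟫ = ±6` in the integer model), i.e.
  `⟪c, A(intVec (1,1,1))⟫ = ∓ 6/√18 ≠ 0`: **the mirror plane of the read does not contain the chain direction**.  For the census: chains in the in-plane
  classes of the letter plane `n_k` never read `n_k` itself — reads of level `k` are on OTHER planes (bands, (I5)) or, after a coincidence continuation,
  on the next letter's plane.
* `located_end_closePacked_classification` — the dichotomy packaged: `IsClosePackedDozenAt e D`, `e − c ∈ D`, `e + c ∉ D` ⇒ hcp-type with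
  `⟪c, axis⟫ ≠ 0`.
WHAT THIS IS NOT: the count of reads, E1-type certificates, or any energy statement; F-C1 not moved.
-/

noncomputable section

namespace Summit.Ventures.Crystal3D.Theorems

open Finset Literature.Geometry.DiscreteGeometry
open scoped RealInnerProductSpace

/-- `intVec (−v) = − intVec v`. -/
private theorem intVec_neg' (v : Fin 3 → ℤ) : intVec (-v) = -intVec v := by
  ext i; simp [intVec]

/-- The cuboctahedron is centrally symmetric (local copy; cf. …SaturatedPocket). -/
private theorem neg_mem_fccKissingPattern' {p : EuclideanSpace ℝ (Fin 3)} (hp : p ∈ fccKissingPattern) : -p ∈ fccKissingPattern := by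
  obtain ⟨v, hv, rfl⟩ := Finset.mem_image.1 hp
  have key : ∀ v ∈ fccInt, -v ∈ fccInt := by decide
  refine Finset.mem_image.2 ⟨-v, key v hv, ?_⟩
  rw [intVec_neg', smul_neg]

/-- The hexagon of the anticuboctahedron is centrally symmetric: a NON-cap vector (`v·(1,1,1) = 0`) has its negative in the pattern; the caps
(`v·(1,1,1) = ±6`) do not. -/
theorem hcpInt_neg_mem_iff : ∀ v ∈ hcpInt, (-v ∈ hcpInt ↔ v 0 + v 1 + v 2 = 0) := by decide

/-- Cap vectors of the hcp integer model have `v·(1,1,1) = ±6`; hexagon vectors `0`. -/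
theorem hcpInt_sum_cases : ∀ v ∈ hcpInt, v 0 + v 1 + v 2 = 0 ∨ v 0 + v 1 + v 2 = 6 ∨ v 0 + v 1 + v 2 = -6 := by decide

/-- **No read inside a grain**: an fcc-type dozen around `e` containing `e − c` contains `e + c`. -/
theorem not_fcc_read (A : EuclideanSpace ℝ (Fin 3) →ₗᵢ[ℝ] EuclideanSpace ℝ (Fin 3)) {e c : EuclideanSpace ℝ (Fin 3)}
    {D : Finset (EuclideanSpace ℝ (Fin 3))}
    (hA : (↑D : Set (EuclideanSpace ℝ (Fin 3))) = (fun p => A p + e) '' (↑fccKissingPattern : Set (EuclideanSpace ℝ (Fin 3))))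
    (hm : e - c ∈ D) : e + c ∈ D := by
  have hm' : e - c ∈ (fun p => A p + e) '' (↑fccKissingPattern : Set _) := by rw [← hA]; exact Finset.mem_coe.2 hm
  obtain ⟨p, hp, hpe⟩ := hm'
  have hc : c = -(A p) := by
    have : A p = -c := by
      have := congrArg (fun x => x - e) hpe
      simpa using this
    rw [this, neg_neg]
  rw [← Finset.mem_coe, hA]
  refine ⟨-p, Finset.mem_coe.2 (neg_mem_fccKissingPattern' (Finset.mem_coe.1 hp)), ?_⟩
  show A (-p) + e = e + c
  rw [map_neg, hc, add_comm]

/-- **A read is polar**: if an hcp-type dozen `A·hcp + e` contains `e − c` but not `e + c`, then `−c` is the image of a CAP vector: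
`⟪c, A (intVec (1,1,1))⟫ = 6/√18` or `= −6/√18` — the mirror plane (normal `A(1,1,1)`) does not contain `c`. -/
theorem read_is_polar (A : EuclideanSpace ℝ (Fin 3) →ₗᵢ[ℝ] EuclideanSpace ℝ (Fin 3)) {e c : EuclideanSpace ℝ (Fin 3)}
    {D : Finset (EuclideanSpace ℝ (Fin 3))}
    (hA : (↑D : Set (EuclideanSpace ℝ (Fin 3))) = (fun p => A p + e) '' (↑hcpKissingPattern : Set (EuclideanSpace ℝ (Fin 3))))
    (hm : e - c ∈ D) (hn : e + c ∉ D) :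
    ⟪c, A (intVec ![1, 1, 1])⟫ = 6 / Real.sqrt (18 : ℕ) ∨ ⟪c, A (intVec ![1, 1, 1])⟫ = -(6 / Real.sqrt (18 : ℕ)) := by
  have hm' : e - c ∈ (fun p => A p + e) '' (↑hcpKissingPattern : Set _) := by rw [← hA]; exact Finset.mem_coe.2 hm
  obtain ⟨p, hp, hpe⟩ := hm'
  obtain ⟨v, hv, rfl⟩ := Finset.mem_image.1 (Finset.mem_coe.1 hp)
  have hc : c = -(A ((Real.sqrt (18 : ℕ))⁻¹ • intVec v)) := by
    have : A ((Real.sqrt (18 : ℕ))⁻¹ • intVec v) = -c := by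
      have := congrArg (fun x => x - e) hpe
      simpa using this
    rw [this, neg_neg]
  -- `v` is not a hexagon vector: otherwise `-v ∈ hcpInt` and `e + c ∈ D`
  have hsum := hcpInt_sum_cases v hv
  have hnothex : ¬ (v 0 + v 1 + v 2 = 0) := by
    intro h0
    have hneg : -v ∈ hcpInt := (hcpInt_neg_mem_iff v hv).2 h0
    apply hn
    rw [← Finset.mem_coe, hA]
    refine ⟨(Real.sqrt (18 : ℕ))⁻¹ • intVec (-v), Finset.mem_coe.2 (Finset.mem_image_of_mem _ hneg), ?_⟩
    show A ((Real.sqrt (18 : ℕ))⁻¹ • intVec (-v)) + e = e + c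
    rw [intVec_neg', smul_neg, map_neg, hc, add_comm]
  -- compute the inner product
  have hs0 : (0 : ℝ) < Real.sqrt (18 : ℕ) := by positivity
  have hinner : ⟪c, A (intVec ![1, 1, 1])⟫ = -((Real.sqrt (18 : ℕ))⁻¹ * ((v 0 + v 1 + v 2 : ℤ) : ℝ)) := by
    rw [hc, inner_neg_left, LinearIsometry.inner_map_map, real_inner_smul_left]
    congr 2
    push_cast
    simp [intVec, PiLp.inner_apply, Fin.sum_univ_three, mul_comm]
  rcases hsum with h0 | h6 | h6
  · exact absurd h0 hnothex
  · right; rw [hinner, h6]; push_cast; rw [inv_mul_eq_div]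
  · left; rw [hinner, h6]; push_cast; rw [neg_mul_eq_mul_neg, neg_neg, inv_mul_eq_div]

/-- **CLASSIFICATION OF READS**: a close-packed dozen around `e` containing `e − c` but not `e + c` is hcp-type, presented by some `A` with
`⟪c, A(1,1,1)⟫ ≠ 0` — the read's mirror plane does not contain the chain direction. -/
theorem located_end_closePacked_classification {e c : EuclideanSpace ℝ (Fin 3)} {D : Finset (EuclideanSpace ℝ (Fin 3))}
    (hD : IsClosePackedDozenAt e D) (hm : e - c ∈ D) (hn : e + c ∉ D) :
    ∃ A : EuclideanSpace ℝ (Fin 3) →ₗᵢ[ℝ] EuclideanSpace ℝ (Fin 3),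
      (↑D : Set (EuclideanSpace ℝ (Fin 3))) = (fun p => A p + e) '' (↑hcpKissingPattern : Set (EuclideanSpace ℝ (Fin 3))) ∧
      ⟪c, A (intVec ![1, 1, 1])⟫ ≠ 0 := by
  obtain ⟨A, hA | hA⟩ := hD
  · exact absurd (not_fcc_read A hA hm) hn
  · refine ⟨A, hA, ?_⟩
    have hs0 : (0 : ℝ) < Real.sqrt (18 : ℕ) := by positivity
    rcases read_is_polar A hA hm hn with h | h <;> rw [h]
    · positivity
    · have : (0 : ℝ) < 6 / Real.sqrt (18 : ℕ) := by positivity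
      linarith

end Summit.Ventures.Crystal3D.Theorems

end
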